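import Literature.AlgebraicGeometry.Morphisms.CechUnitCocycleModelData
import Literature.AlgebraicGeometry.Morphisms.CechUnitCocycleLiftInduction
import HarnessLib

/-!
# The model tower with level-indexed (Artinian) charts ⟹ a lift model

`ModelTower₂ f U` — the AV-free content of the dictionary «`(1 × g_φ)^*𝒫 ≅ ℒ|_{A₀ × Spec R_n}` ⟺ the model cocycles are
related» along [MumfordAV1970] §13 (proof of the Theorem pp. 125–130): a tower of augmented small extensions `R (n+1) → R n`,
thickenings `Y n` with covering families and model data, transitions, the restricted bundles `L n` with frames, LEVEL-INDEXED
chart rings `B n` («`𝒪_{Â,y₀}/𝔪^{n+1}`», after the single-chart version was refuted: no affine chart of `A₀ × Â` carries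
transition data for `𝒫`) with chart thickenings, chart bundles with frames, classifying maps of chart points and the
comparison one level up; `ModelTower₂.liftModel : LiftModel₂ f U` with the `model` field PROVED (`ModelTower₂.model`:
frames normalised against `p.map φ'` have the same reduction, and related lifts are graph points — [GortzWedhorn2023]
Lemma 26.15 in cocycle form).
HC_CM is proved only modulo the 7 printed citations until rung 0 closes.

## References
* [MumfordAV1970] D. Mumford, *Abelian Varieties*, §13 (proof of the Thm. pp. 125–130).
* [GortzWedhorn2023] U. Görtz, T. Wedhorn, *Algebraic Geometry II*, Lemma 26.15, Prop. 27.122.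
-/

noncomputable section

universe u v

open TensorProduct CategoryTheory AlgebraicGeometry
open Literature.RingTheory.Flat Literature.RingTheory.Flat.IsSmallExtension

namespace Literature.AlgebraicGeometry.Morphisms.CechUnitCocycle

open Literature.AlgebraicGeometry.Modules Opposite TopologicalSpace

section Tower2

variable {A : Type u} [CommRing A] {X : Scheme.{u}} {f : X ⟶ Spec (.of A)} {ι : Type v} {U : ι → X.Opens}

variable (f U) in
/-- **A MODEL TOWER WITH LEVEL-INDEXED (ARTINIAN) CHARTS** (see `ModelTower`; the chart thickening `YB n`
«= `A₀ × Spec 𝒪_{Â,y₀}/𝔪^{n+1}`», its bundle `PB n` WITH frames (nilpotent Nakayama), classifying maps `gφ n φ : Y n → YB n`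
of chart points and `gUp n φ : Y n → YB (n+1)` of `φ ∘ β n`, with the comparison `chartUp`).  Plumbing structure.
[cite: MumfordAV1970, §13 (proof of the Thm. pp. 125–130)] -/
structure ModelTower₂ where
  /-- levels -/
  R : ℕ → Type u
  /-- ring structures -/
  commRing : ∀ n, CommRing (R n)
  /-- algebra structures -/
  algebra : ∀ n, Algebra A (R n)
  /-- transitions -/
  π : ∀ n, R (n + 1) →ₐ[A] R n
  /-- augmentations -/
  ρ : ∀ n, R n →ₐ[A] A
  /-- kernels -/
  I : ∀ n, Ideal (R (n + 1))
  /-- ranks -/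
  d : ℕ → ℕ
  /-- frames of the kernels -/
  e : ∀ n, (Fin (d n) → A) ≃ₗ[A] I n
  /-- small extensions -/
  small : ∀ n, IsSmallExtension (π n) (ρ (n + 1)) (I n) (e n)
  /-- compatibility of augmentations -/
  hρ : ∀ n, (ρ n).comp (π n) = ρ (n + 1)
  /-- thickenings -/
  Y : ℕ → Scheme.{u}
  /-- covers -/
  W : ∀ n, ι → (Y n).Opens
  /-- the covers cover -/
  hW : ∀ n, iSup (W n) = ⊤
  /-- model data -/
  Φ : ∀ n, ModelData f U (R n) (Y n) (W n)
  /-- transitions of thickenings -/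
  τ : ∀ n, Y n ⟶ Y (n + 1)
  /-- model data along transitions -/
  homτ : ∀ n, (Φ (n + 1)).Hom (Φ n) (π n) (τ n)
  /-- restricted bundles -/
  L : ∀ n, (Y n).Modules
  /-- their frames -/
  FL : ∀ n, IFrames (L n) (W n)
  /-- restriction along transitions -/
  Lτ : ∀ n, (Scheme.Modules.pullback (τ n)).obj (L (n + 1)) ≅ L n
  /-- chart rings -/
  B : ℕ → Type u
  /-- ring structures -/
  commRingB : ∀ n, CommRing (B n)
  /-- algebra structures -/
  algebraB : ∀ n, Algebra A (B n)
  /-- chart reductions -/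
  β : ∀ n, B (n + 1) →ₐ[A] B n
  /-- base points -/
  ev : ∀ n, B n →ₐ[A] A
  /-- compatibility of base points -/
  hev : ∀ n, (ev n).comp (β n) = ev (n + 1)
  /-- chart thickenings -/
  YB : ℕ → Scheme.{u}
  /-- their covers -/
  WB : ∀ n, ι → (YB n).Opens
  /-- chart model data -/
  ΦB : ∀ n, ModelData f U (B n) (YB n) (WB n)
  /-- chart bundles -/
  PB : ∀ n, (YB n).Modules
  /-- their frames -/
  FP : ∀ n, IFrames (PB n) (WB n)
  /-- classifying maps of chart points -/
  gφ : ∀ n, (B n →ₐ[A] R n) → (Y n ⟶ YB n)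
  /-- model data along chart points -/
  homφ : ∀ n (φ : B n →ₐ[A] R n), (ΦB n).Hom (Φ n) φ (gφ n φ)
  /-- classifying maps one chart level up -/
  gUp : ∀ n, (B n →ₐ[A] R n) → (Y n ⟶ YB (n + 1))
  /-- model data along them -/
  homUp : ∀ n (φ : B n →ₐ[A] R n), (ΦB (n + 1)).Hom (Φ n) (φ.comp (β n)) (gUp n φ)
  /-- the two chart presentations of `(1 × g_φ)^*𝒫` agree -/
  chartUp : ∀ n (φ : B n →ₐ[A] R n),
    (Scheme.Modules.pullback (gφ n φ)).obj (PB n) ≅ (Scheme.Modules.pullback (gUp n φ)).obj (PB (n + 1))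
  /-- a framed graph point at level `0` -/
  base : ∃ φ₀ : B 0 →ₐ[A] R 0, Nonempty ((Scheme.Modules.pullback (gφ 0 φ₀)).obj (PB 0) ≅ L 0) ∧ (ρ 0).comp φ₀ = ev 0
  /-- graph points lift -/
  lift : ∀ n (φ : B n →ₐ[A] R n), Nonempty ((Scheme.Modules.pullback (gφ n φ)).obj (PB n) ≅ L n) →
    ∃ φ' : B (n + 1) →ₐ[A] R (n + 1), (π n).comp φ' = φ.comp (β n)

attribute [instance] ModelTower₂.commRing ModelTower₂.algebra ModelTower₂.commRingB ModelTower₂.algebraB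

namespace ModelTower₂

variable (𝕋 : ModelTower₂ f U)

/-- Transition data of the chart bundle at level `n`. [folklore] -/
def p (n : ℕ) : UCocycle f U (𝕋.B n) := (𝕋.ΦB n).cocycle (𝕋.FP n)

/-- `(1 × g_φ)^*𝒫` at a chart point. [folklore] -/
abbrev Mφ (n : ℕ) (φ : 𝕋.B n →ₐ[A] 𝕋.R n) : (𝕋.Y n).Modules := (Scheme.Modules.pullback (𝕋.gφ n φ)).obj (𝕋.PB n)

/-- Its frames from the level-`n` chart. [folklore] -/
def FM (n : ℕ) (φ : 𝕋.B n →ₐ[A] 𝕋.R n) : IFrames (𝕋.Mφ n φ) (𝕋.W n) :=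
  ((𝕋.FP n).pullback (𝕋.gφ n φ)).cast (funext (𝕋.homφ n φ).preimage)

/-- **`(1 × g_φ)^*𝒫` has model cocycle `(p n).map φ`.** [cite: MumfordAV1970, §13 (proof of the Thm. pp. 125–130)] -/
theorem cocycle_FM (n : ℕ) (φ : 𝕋.B n →ₐ[A] 𝕋.R n) (a b : ι) :
    ((𝕋.Φ n).cocycle (𝕋.FM n φ)).val a b = ((𝕋.p n).map φ).val a b := by
  refine (𝕋.homφ n φ).cocycle_pullback (𝕋.FP n) (𝕋.FM n φ) (fun a b => ?_) a b
  rw [FM, IFrames.tf_cast, IFrames.tf_pullback]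
  change ((𝕋.gφ n φ).appLE _ _ _ ≫ (𝕋.Y n).presheaf.map _) ((𝕋.FP n).tf a b) = _
  rw [Scheme.Hom.appLE_map]

/-- Its frames from the level-`(n+1)` chart. [folklore] -/
def FMUp (n : ℕ) (φ : 𝕋.B n →ₐ[A] 𝕋.R n) : IFrames (𝕋.Mφ n φ) (𝕋.W n) :=
  ((((𝕋.FP (n + 1)).pullback (𝕋.gUp n φ)).cast (funext (𝕋.homUp n φ).preimage))).mapIso (𝕋.chartUp n φ).symm

/-- **`(1 × g_φ)^*𝒫` has model cocycle `(p (n+1)).map (φ ∘ β n)` in the frames from one chart level up.** [cite: MumfordAV1970, §13 (proof of the Thm. pp. 125–130)] -/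
theorem cocycle_FMUp (n : ℕ) (φ : 𝕋.B n →ₐ[A] 𝕋.R n) (a b : ι) :
    ((𝕋.Φ n).cocycle (𝕋.FMUp n φ)).val a b = ((𝕋.p (n + 1)).map (φ.comp (𝕋.β n))).val a b := by
  rw [FMUp, ModelData.cocycle_mapIso]
  refine (𝕋.homUp n φ).cocycle_pullback (𝕋.FP (n + 1)) _ (fun a b => ?_) a b
  rw [IFrames.tf_cast, IFrames.tf_pullback]
  change ((𝕋.gUp n φ).appLE _ _ _ ≫ (𝕋.Y n).presheaf.map _) ((𝕋.FP (n + 1)).tf a b) = _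
  rw [Scheme.Hom.appLE_map]

/-- The frames of `L n` from `FL (n+1)`. [folklore] -/
def FLτ (n : ℕ) : IFrames (𝕋.L n) (𝕋.W n) :=
  (((𝕋.FL (n + 1)).pullback (𝕋.τ n)).cast (funext (𝕋.homτ n).preimage)).mapIso (𝕋.Lτ n)

/-- Their model cocycle is the reduction. [cite: MumfordAV1970, §13 (proof of the Thm. pp. 125–130)] -/
theorem cocycle_FLτ (n : ℕ) (a b : ι) :
    ((𝕋.Φ n).cocycle (𝕋.FLτ n)).val a b = (((𝕋.Φ (n + 1)).cocycle (𝕋.FL (n + 1))).map (𝕋.π n)).val a b := by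
  rw [FLτ, ModelData.cocycle_mapIso]
  refine (𝕋.homτ n).cocycle_pullback (𝕋.FL (n + 1)) _ (fun a b => ?_) a b
  rw [IFrames.tf_cast, IFrames.tf_pullback]
  change ((𝕋.τ n).appLE _ _ _ ≫ (𝕋.Y n).presheaf.map _) ((𝕋.FL (n + 1)).tf a b) = _
  rw [Scheme.Hom.appLE_map]

/-- The graph predicate at level `n`: the chart point `φ` classifies the bundle of the tower
(`Mφ n φ ≅ L n`) and lies over the base point. [cite: MumfordAV1970, §13 (proof of the Thm. pp. 125–130)] -/
def Graph (n : ℕ) (φ : 𝕋.B n →ₐ[A] 𝕋.R n) : Prop := Nonempty (𝕋.Mφ n φ ≅ 𝕋.L n) ∧ (𝕋.ρ n).comp φ = 𝕋.ev n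

/-- **THE COCYCLE MODEL OF THE GRAPH CONDITION (level-indexed charts).** [cite: MumfordAV1970, §13 (proof of the Thm. pp. 125–130)] -/
theorem model (n : ℕ) (φ : 𝕋.B n →ₐ[A] 𝕋.R n) (hφ : 𝕋.Graph n φ) (φ' : 𝕋.B (n + 1) →ₐ[A] 𝕋.R (n + 1))
    (hφ' : (𝕋.π n).comp φ' = φ.comp (𝕋.β n)) :
    ∃ ℓ' : UCocycle f U (𝕋.R (n + 1)), SameRed ((𝕋.p (n + 1)).map φ') ℓ' (𝕋.π n) ∧
      ∀ (φ'' : 𝕋.B (n + 1) →ₐ[A] 𝕋.R (n + 1)) (h : UCochain0 f U (𝕋.R (n + 1))), (𝕋.π n).comp φ'' = φ.comp (𝕋.β n) →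
        (∀ i, coef f (𝕋.π n) (U i) (h i : Sections f (U i) ⊗[A] 𝕋.R (n + 1)) = 1) →
        Rel ((𝕋.p (n + 1)).map φ'') ℓ' (fun i => (h i : Sections f (U i) ⊗[A] 𝕋.R (n + 1))) → 𝕋.Graph (n + 1) φ'' := by
  obtain ⟨⟨ψ⟩, hev⟩ := hφ
  set ℓ₁ : UCocycle f U (𝕋.R (n + 1)) := (𝕋.Φ (n + 1)).cocycle (𝕋.FL (n + 1)) with hℓ₁
  have hrel₀ := (𝕋.Φ n).rel_cocycle_chg ((𝕋.FMUp n φ).mapIso ψ) (𝕋.FLτ n)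
  have hval1 : ∀ a b, ((𝕋.Φ n).cocycle ((𝕋.FMUp n φ).mapIso ψ)).val a b =
      (((𝕋.p (n + 1)).map φ').map (𝕋.π n)).val a b := by
    intro a b
    rw [ModelData.cocycle_mapIso, cocycle_FMUp, UCocycle.map_map_val, hφ']
  have hval2 : ∀ a b, ((𝕋.Φ n).cocycle (𝕋.FLτ n)).val a b = (ℓ₁.map (𝕋.π n)).val a b := fun a b => 𝕋.cocycle_FLτ n a b
  set h₀ : UCochain0 f U (𝕋.R n) := fun a => ((𝕋.Φ n).isUnit_symm_chg ((𝕋.FMUp n φ).mapIso ψ) (𝕋.FLτ n) a).unit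
    with hh₀
  have hrel₂ : Rel (((𝕋.p (n + 1)).map φ').map (𝕋.π n)) (ℓ₁.map (𝕋.π n))
      (fun a => (h₀ a : Sections f (U a) ⊗[A] 𝕋.R n)) := by
    intro a b
    have := hrel₀ a b
    rw [hval1, hval2] at this
    simp only [hh₀, IsUnit.unit_spec]
    exact this
  have hrel₃ := Rel.symm_units hrel₂
  obtain ⟨h₁, -, hsame⟩ := exists_twist_sameRed (𝕋.small n) (𝕋.hρ n) ((𝕋.p (n + 1)).map φ') ℓ₁
    (fun a => (h₀ a)⁻¹) hrel₃
  refine ⟨ℓ₁.twist h₁, hsame, fun φ'' h hφ'' h1 hrel => ⟨?_, ?_⟩⟩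
  · have hA : Rel (ℓ₁.twist h₁) ℓ₁ (fun i => ((h₁ i)⁻¹ : (Sections f (U i) ⊗[A] 𝕋.R (n + 1))ˣ)) :=
      Rel.symm_units (rel_twist ℓ₁ h₁)
    have hB := Rel.trans' hrel hA
    have hB' : Rel ((𝕋.Φ (n + 1)).cocycle (𝕋.FM (n + 1) φ'')) ((𝕋.Φ (n + 1)).cocycle (𝕋.FL (n + 1)))
        (fun i => ((h₁ i)⁻¹ : (Sections f (U i) ⊗[A] 𝕋.R (n + 1))ˣ) * (h i : Sections f (U i) ⊗[A] 𝕋.R (n + 1))) := by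
      intro a b
      have := hB a b
      rw [← 𝕋.cocycle_FM (n + 1) φ'' a b] at this
      exact this
    exact (𝕋.Φ (n + 1)).nonempty_iso_of_rel (𝕋.hW (n + 1)) _ _ _ (fun a => ((h₁ a)⁻¹.isUnit).mul (h a).isUnit) hB'
  · rw [← 𝕋.hρ n, AlgHom.comp_assoc, hφ'', ← AlgHom.comp_assoc, hev, 𝕋.hev]

/-- **THE LIFT MODEL OF A MODEL TOWER (level-indexed charts).** [cite: MumfordAV1970, §13 (proof of the Thm. pp. 125–130)] -/
def liftModel : LiftModel₂ f U where
  R := 𝕋.R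
  commRing := 𝕋.commRing
  algebra := 𝕋.algebra
  π := 𝕋.π
  ρ := 𝕋.ρ
  I := 𝕋.I
  d := 𝕋.d
  e := 𝕋.e
  small := 𝕋.small
  hρ := 𝕋.hρ
  B := 𝕋.B
  commRingB := 𝕋.commRingB
  algebraB := 𝕋.algebraB
  β := 𝕋.β
  ev := 𝕋.ev
  hev := 𝕋.hev
  p := 𝕋.p
  Graph := 𝕋.Graph
  graph_ev n φ h := h.2
  base := by
    obtain ⟨φ₀, h1, h2⟩ := 𝕋.base
    exact ⟨φ₀, h1, h2⟩
  lift n φ h := 𝕋.lift n φ h.1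
  model := 𝕋.model

/-- The graph predicate of the lift model is the tower's. [cite: MumfordAV1970, §13 (proof of the Thm. pp. 125–130)] -/
theorem liftModel_graph (n : ℕ) (φ : 𝕋.B n →ₐ[A] 𝕋.R n) : 𝕋.liftModel.Graph n φ ↔ 𝕋.Graph n φ := Iff.rfl

/-- The chart data of the lift model. [cite: MumfordAV1970, §13 (proof of the Thm. pp. 125–130)] -/
theorem liftModel_p (n : ℕ) : 𝕋.liftModel.p n = 𝕋.p n := rfl

/-- The base points of the lift model. [cite: MumfordAV1970, §13 (proof of the Thm. pp. 125–130)] -/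
theorem liftModel_ev (n : ℕ) : 𝕋.liftModel.ev n = 𝕋.ev n := rfl

end ModelTower₂

end Tower2

end Literature.AlgebraicGeometry.Morphisms.CechUnitCocycle

end
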